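import Literature.MathematicalPhysics.QuantumFieldTheory.Balaban1983to89.Node00.LargeFieldBackgroundCoOfRecord
import Literature.MathematicalPhysics.QuantumFieldTheory.Balaban1983to89.Node00.StepWeightsOfRecord

/-!
# NODE 00 (definitions of record, R-side ₇, FILE 22′) — print's regular space `U_k({Ω_j}_{j=0}^{k}, ε₀)` ON ITS SUPPORT `Ω₀` and the (2.12)
# background over it, of record — the SUPPORT EDITION (`…CoP…`) of FILE 22

T. Bałaban, *The variational problem and background fields in renormalization group method for lattice gauge theories*, Commun. Math. Phys.
**102** (1985) 277–309 [Balaban1985Variational] = [15], p. 277 [PDF 1] (1): *«a sequence of domains Ω_j, j = 0, 1, …, k, … Ω₀ ⊇ Ω₁ ⊇ … ⊇ Ω_k»*;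
p. 278 [PDF 2] (2): *«The space U_k({Ω_j}, ε₀) of gauge field configurations on Ω₀ was defined in Sect. A of [6] by the conditions
|U(∂p) − 1| < ε₀L^{−2j} for p ∈ Ω_j, |(D^{η*}_U ∂U)(b)| < ε₀L^{−2j}(L^jη)^{−1} for b ∈ Ω_j»* (j = 0, …, k), (3) the data `Ū_j = V` on `Λ_j ⊆ Ω_j ∖ Ω_{j+1}`,
(5) *«A(U) = Σ_{p ⊂ Ω₀} …»*, (6) the space `U_k({Ω_j}, ε₀) ∩ 𝔘(𝔅_k, V)`; [6] = T. Bałaban, *Spaces of regular gauge field configurations on a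
lattice and gauge fixing conditions*, Commun. Math. Phys. **99** (1985) 75–102 [Balaban1985RegularSpaces], (1.7), (1.9) p. 77 *«for p ∈ Ω_j (resp.
b ∈ Ω_j), j = 0, 1, …, k»*; T. Bałaban, *Convergent renormalization expansions for lattice gauge theories*, Commun. Math. Phys. **119** (1988) 243–285
[Balaban1988Convergent] = [III], p. 255: *«the domain Ω₁, or rather a small neighborhood of Ω₁ including a layer of M₁-cubes, is called its
support»*, p. 256: *«Ω_n is a union of LⁿξM₁-cubes»*, (1.12) p. 248 *«U = V₀ on Ω₁ᶜ»*, (2.12) p. 256 *«the functional U ↦ A(U) on U: U regular and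
M_𝔅(U) = V»*.

HONEST FRAMING (cell `pub-ymgap`, definer seat node00-def-R g16): definitions of record; nothing of Bałaban asserted ([15] Thm 1 existence ∕
uniqueness — NOT asserted: solvability stays the membership `W ∈ solvableDom …` wherever used); K0⁗ not discharged; counts unmoved; finite 𝕋⁴ at
fixed ε; not continuum ∕ OS ∕ mass-gap ∕ Clay.

WHY THIS FILE (director-ym LINE №160 (1) «F7-b», №161 (2) «(y) CONFIRMED BY THE TREE»; node00-def-T LOCATED-7 (L3) + SCOPE INPUT (S); node00-def-P11
(B1)–(B3); FINDING №7).  FILE 16 ∕ FILE 22 read print's scale-`0` domain as the WHOLE TORUS — `omegaPlaqs Ω 0 = Set.univ` in the (1.7) clauses,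
node00-def-P11's `Sect2.omegaBonds Ω 0 = Set.univ` in the (1.9) clauses, FILE 13's `regSuppOfRecord` at `genSet s.Ω k 0 = pts 0 (Ω 1)ᶜ` in the data
envelope — the small-field papers' `Ω₀ = T_η` ([6] (1.3)).  In the complete model ([III] p. 243 «without any restrictions on field variables») the
retained scale-`0` variables `V₀ = U|_{Ω₁ᶜ}` are ROUGH on the large-field region `P₀ ⊂ Ω₁ᶜ` ((1.1), (1.10)–(1.11) p. 246–248) and the variational
problem (2.12) reads them only as the constraint «U = V₀ on Ω₁ᶜ» ((1.12) p. 248) and through the class ∕ action posed ON THE SUPPORT `Ω₀` ([15] (2), (5);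
[III] p. 255).  With `Ω₀ = T_η` the class of record is EMPTY at every datum rough on one plaquette of `Ω₁ᶜ` (FILE 22
`not_mem_solvableDom_regMSCo_of_le_plaq`: the constraint pins `U = W₀` there), and the background of record takes its junk branch — masked today by
12a's generation-`0` regularity cut, unmasked by 12a″ (F7-a).  THIS FILE re-ranges the THREE scale-`0` clauses to a support set `Ω₀` — generically
(`…At … Ω₀ …`) and at the located support of record `suppDomOfRecord ν K Ω = Ω₁ + one layer of M₁-cubes` (n02-b's `hullD`) — leaving EVERYTHING ELSE
of FILE 1 ∕ 16 ∕ 22 untouched: the averaging `avOfRecord`, the determining sets `genSet` (so «U = V₀ on Ω₁ᶜ» STAYS the δ-constraint — fixing `U`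
beyond `Ω₀` changes no argmin, [15] (5)'s extra plaquettes are constants), FILE 1's `bgOfRecord` ∕ `solvableDom` ∕ `UminOfRecord` (total, junk `1`
off the solvable set), r11's `B14.Eq218Concrete.Ubg`.  Append-only beside FILE 22 (which stays: its objects are the `Ω₀ = T_η` specialisation,
`regMSCoPOfRecordAt_univ`).  The of-record objects KEEP FILE 22's ARITIES (`regMSCoPOfRecord F N ν K k Ω`, `bgMSCoPOfRecord F N ν K k Ω`,
`UbgMSCoPOfRecord F N ν M g K k s`), so the Stage-13 `CoP` edition (node00-def-T) and the key texts (pub-ymgap-plan) re-key by a pure token swap.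

WHAT THIS FILE TYPES.  §0 `topSeq Ω₀ Ω` — print's `{Ω_j}_{j=0}^{k}` with `Ω₀` explicit (r11's sequences carry `Ω 0 = ∅`, `Seq.Ω_off`).  §1 the support
of record `suppDomOfRecord ν K Ω := hullD (F.P K) ν.M₁ 1 (Ω 1)` ([III] p. 255; the `M₁`-cubes = the `L⁰ξM₁`-cubes of (2.13), side
`B14.Eq213MaximalDomains.side L M₁ 0 = M₁` fine sites — a LOCATED letter).  §2 the class `regMSCoPOfRecordAt F N ν K k Ω₀ Ω` = [15] (2) verbatim —
(1.7) on `plaqsOf (topSeq Ω₀ Ω j)` (thresholds `εreg·η_j²`) AND (1.9) `Sect2.CoDivSmallOn (bondsOf (topSeq Ω₀ Ω j))` (thresholds `εreg·η_j³`), every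
`j ≤ k` — its faces, antitonicity in `Ω₀`, the junctions `regMSCoOfRecord ⊆ regMSCoPOfRecordAt … Ω₀` (FILE 22's class is the print-STRONGER one) and
`regMSCoPOfRecordAt … Set.univ … = regMSCoOfRecord …`; the class of record `regMSCoPOfRecord … Ω := regMSCoPOfRecordAt … (suppDomOfRecord ν K Ω) Ω`.
§3 the (2.12) data `bgMSCoPOfRecordAt` ∕ `bgMSCoPOfRecord` (FILE 1's `bgOfRecord` in the new class) and the backgrounds `UbgMSCoPOfRecordAt` ∕
`UbgMSCoPOfRecord` (r11's `Ubg` at those data) with FILE 22's face set token for token (`_apply`, `isMinimizer_…`, membership, (1.7) ∕ (1.9) at the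
minimiser, `agreeOn_…`, `_of_not_mem`, `_eq_one_of_not_mem`) and the support reading of FILE 22's `Γ₀` clause (solvability forces the `W₀`-plaquette
bound on the support's plaquettes with three corners in `Ω₁ᶜ` — and on no other).  §4 the data envelope `regSuppPOfRecord ν M g K k cR s` = FILE 13's
`regSuppOfRecord` with the scale-`0` clause re-ranged to the COLLAR `Λ₀ := pts 0 (Ω₀ ∖ Ω₁)` ([15] (3) «Λ_j ⊆ Ω_j ∖ Ω_{j+1}»), scales `1 ≤ j ≤ k` verbatim.

NOT IN THIS FILE (one declarer each): the Stage-13 `CoP` record ∕ proviso rows ∕ `UbgOfRecord₁₃CoP` (node00-def-T), the (1.9)∕(7) data clauses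
`Sect2.CoDivSmallOn`-side twins and the [15] facts at this class (node00-def-P11), the 𝐓-weights 12a″ and the collar-regularity lemma (node00-def-T),
selectors (node00-def-K0a∕K0c), the `Ω₁ = ∅` step-zero faces (a later theorem-only leaf).  No instance, no notation, no `sorry`; nothing landed is edited.
[cite: Balaban1985Variational, (1) p.277, (2),(3),(5),(6) p.278; Balaban1985RegularSpaces, (1.7),(1.9) p.77; Balaban1988Convergent, p.255, (2.12)–(2.13) p.256–257, (1.12) p.248]
-/

noncomputable section

namespace Literature.MathematicalPhysics.QuantumFieldTheory.Balaban1983to89.Node00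

open Literature.MathematicalPhysics.QuantumFieldTheory.Balaban1983to89
open T4Continuum B15DeterminingSets

/-! ## §0  Print's domain sequence `{Ω_j}_{j=0}^{k}` with `Ω₀` explicit -/

section TopSeq

variable {P : Params}

/-- **`{Ω_j}_{j=0}^{k}` WITH THE SCALE-`0` DOMAIN EXPLICIT**: `topSeq Ω₀ Ω 0 = Ω₀`, `topSeq Ω₀ Ω j = Ω j` for `j ≥ 1` (r11's sequences `s.Ω`
start at scale `1`: `Seq.Ω_off` puts `Ω 0 = ∅`). [cite: Balaban1985Variational, (1) p.277] -/
def topSeq (Ω₀ : Set (Site P 0)) (Ω : ℕ → Set (Site P 0)) : ℕ → Set (Site P 0) :=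
  fun j => if j = 0 then Ω₀ else Ω j

/-- Scale `0` is `Ω₀`. [cite: Balaban1985Variational, (1) p.277 (bookkeeping)] -/
@[simp] theorem topSeq_zero (Ω₀ : Set (Site P 0)) (Ω : ℕ → Set (Site P 0)) : topSeq Ω₀ Ω 0 = Ω₀ := rfl

/-- A positive scale is the sequence's own domain. [cite: Balaban1985Variational, (1) p.277 (bookkeeping)] -/
theorem topSeq_of_ne_zero (Ω₀ : Set (Site P 0)) (Ω : ℕ → Set (Site P 0)) {j : ℕ} (hj : j ≠ 0) : topSeq Ω₀ Ω j = Ω j := if_neg hj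

/-- Successor scales are the sequence's own domains. [cite: Balaban1985Variational, (1) p.277 (bookkeeping)] -/
@[simp] theorem topSeq_succ (Ω₀ : Set (Site P 0)) (Ω : ℕ → Set (Site P 0)) (j : ℕ) : topSeq Ω₀ Ω (j + 1) = Ω (j + 1) :=
  if_neg (Nat.succ_ne_zero j)

/-- Only the scale-`0` entry depends on `Ω₀`, monotonically. [cite: Balaban1985Variational, (1) p.277 (bookkeeping)] -/
theorem topSeq_mono_top {Ω₀ Ω₀' : Set (Site P 0)} (h : Ω₀ ⊆ Ω₀') (Ω : ℕ → Set (Site P 0)) (j : ℕ) : topSeq Ω₀ Ω j ⊆ topSeq Ω₀' Ω j := by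
  rcases eq_or_ne j 0 with rfl | hj
  · simpa using h
  · rw [topSeq_of_ne_zero _ _ hj, topSeq_of_ne_zero _ _ hj]

/-- With `Ω₀ = T_η` the plaquette ranges are FILE 16's `omegaPlaqs`. [cite: Balaban1985RegularSpaces, (1.3),(1.7) p.77 (bookkeeping)] -/
theorem plaqsOf_topSeq_univ (Ω : ℕ → Set (Site P 0)) (j : ℕ) :
    B8Eq17ClassAkV1.plaqsOf (topSeq Set.univ Ω j) = omegaPlaqs Ω j := by
  rcases eq_or_ne j 0 with rfl | hj
  · rw [topSeq_zero, omegaPlaqs_zero, B8Eq17ClassAkV1.plaqsOf_univ]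
  · rw [topSeq_of_ne_zero _ _ hj, omegaPlaqs_of_ne_zero _ hj]

/-- With `Ω₀ = T_η` the bond ranges are node00-def-P11's `Sect2.omegaBonds`. [cite: Balaban1985RegularSpaces, (1.3),(1.9) p.77 (bookkeeping)] -/
theorem bondsOf_topSeq_univ (Ω : ℕ → Set (Site P 0)) (j : ℕ) :
    bondsOf (topSeq Set.univ Ω j) = Sect2.omegaBonds Ω j := by
  rcases eq_or_ne j 0 with rfl | hj
  · rw [topSeq_zero, B8Eq17ClassAkV1.bondsOf_univ]; exact (if_pos rfl).symm
  · rw [topSeq_of_ne_zero _ _ hj]; exact (if_neg hj).symm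

end TopSeq

variable (F : T4Family) (N : ℕ) [NeZero N]

/-! ## §1  The support of record `Ω₀(s) = Ω₁(s) +` one layer of `M₁`-cubes ([III] p. 255) -/

/-- **THE SUPPORT OF RECORD** — [III] p. 255 verbatim: *«the domain Ω₁, or rather a small neighborhood of Ω₁ including a layer of M₁-cubes, is
called its support»*: n02-b's `hullD` (the union of the `s`-cubes of the torus partition lying within `n` layers of a set, `Node00/StepWeightsOfRecord`)
at `n = 1` layer of the `M₁`-cubes of (2.13) at scale `0` (side `B14.Eq213MaximalDomains.side L M₁ 0 = M₁` fine sites; p. 256 «Ω_n is a union of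
LⁿξM₁-cubes») around `Ω₁`.  A LOCATED letter (layer count `1`, cube side `ν.M₁`): the generic objects below (`…At … Ω₀ …`) take any support.
[cite: Balaban1988Convergent, p.255, (2.13) p.256–257] -/
def suppDomOfRecord (ν : Stage7Numerics) (K : ℕ) (Ω : ℕ → Set (Site (F.P K) 0)) : Set (Site (F.P K) 0) :=
  hullD (F.P K) ν.M₁ 1 (Ω 1)

/-- Unfolding (definitional). [cite: Balaban1988Convergent, p.255 (bookkeeping)] -/
theorem suppDomOfRecord_eq (ν : Stage7Numerics) (K : ℕ) (Ω : ℕ → Set (Site (F.P K) 0)) :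
    suppDomOfRecord F ν K Ω = hullD (F.P K) ν.M₁ 1 (Ω 1) := rfl

/-- The support of record reads the sequence only through `Ω₁`. [cite: Balaban1988Convergent, p.255 (bookkeeping)] -/
theorem suppDomOfRecord_congr (ν : Stage7Numerics) (K : ℕ) {Ω Ω' : ℕ → Set (Site (F.P K) 0)} (h : Ω 1 = Ω' 1) :
    suppDomOfRecord F ν K Ω = suppDomOfRecord F ν K Ω' := by rw [suppDomOfRecord, suppDomOfRecord, h]

/-- **THE COLLAR** `Λ₀ = Ω₀ ∖ Ω₁` of the support of record ([15] (3) «Λ₀ ⊆ Ω₀ ∖ Ω₁»): the layer of `M₁`-cubes around `Ω₁` — as an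
intersection with `Ω₁ᶜ` (the shape of a reading-region selector `Y ∩ hullD … Yᶜ` at `Y = Ω₁ᶜ`, up to `compl_compl`).
[cite: Balaban1985Variational, (3) p.278; Balaban1988Convergent, p.255, (1.10) p.248] -/
theorem collar_suppDomOfRecord_eq (ν : Stage7Numerics) (K : ℕ) (Ω : ℕ → Set (Site (F.P K) 0)) :
    suppDomOfRecord F ν K Ω \ Ω 1 = (Ω 1)ᶜ ∩ hullD (F.P K) ν.M₁ 1 (Ω 1) := by
  ext x
  exact ⟨fun hx => ⟨hx.2, hx.1⟩, fun hx => ⟨hx.2, hx.1⟩⟩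

/-- The collar lies in `Ω₁ᶜ = Γ₀` (FILE 13's scale-`0` range `genSet Ω k 0`, `0 < k`). [cite: Balaban1988Convergent, (2.2) p.255 (bookkeeping)] -/
theorem collar_suppDomOfRecord_subset_compl (ν : Stage7Numerics) (K : ℕ) (Ω : ℕ → Set (Site (F.P K) 0)) :
    suppDomOfRecord F ν K Ω \ Ω 1 ⊆ (Ω 1)ᶜ := fun _ hx => hx.2

/-! ## §2  Print's regular space `U_k({Ω_j}_{j=0}^{k}, εreg)` on a support `Ω₀` — [15] (2) = [6] (1.7) ∧ (1.9) — of record -/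

/-- **PRINT'S REGULARITY CLASS OF (2.12) ON A SUPPORT `Ω₀`, OF RECORD** — [15] (2) ∕ [6] (1.7) ∧ (1.9) at the letter `α₀ = ε₀ = ν.εreg`:
`U_k({Ω_j}_{j=0}^{k}, εreg) = {U | |U(∂p) − 1| < εreg·η_j² for p ∈ Ω_j (1.7) and ‖η·(D^{η*}_U ∂U)(b)‖ < εreg·η_j³ for b ∈ Ω_j (1.9), j = 0, …, k}` with the
scale-`0` domain `Ω₀` EXPLICIT (plaquettes ∕ bonds «in Ω_j» = with a corner ∕ an end-point in `Ω_j`, the p. 77 convention: `B8Eq17ClassAkV1.plaqsOf`,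
r12's `bondsOf`; node00-def-P11's set-generic `Sect2.CoDivSmallOn`).  FILE 22's `regMSCoOfRecord` is the case `Ω₀ = T_η` (`regMSCoPOfRecordAt_univ`).
[cite: Balaban1985Variational, (2),(6) p.278; Balaban1985RegularSpaces, (1.7),(1.9) p.77; Balaban1988Convergent, (2.12) p.256] -/
def regMSCoPOfRecordAt (ν : Stage7Numerics) (K k : ℕ) (Ω₀ : Set (Site (F.P K) 0)) (Ω : ℕ → Set (Site (F.P K) 0)) :
    Set (GaugeField (F.P K) 0 (SU N)) :=
  {U | (∀ j, j ≤ k → PlaqSmallOn (B8Eq17ClassAkV1.plaqsOf (topSeq Ω₀ Ω j)) (ν.εreg * (F.P K).eta j ^ 2) U) ∧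
    (∀ j, j ≤ k → Sect2.CoDivSmallOn (bondsOf (topSeq Ω₀ Ω j)) (ν.εreg * (F.P K).eta j ^ 3) U)}

/-- **THE CLASS OF RECORD** — the class on the support of record `Ω₀(s) = suppDomOfRecord ν K Ω` (FILE 22's arity).
[cite: Balaban1985Variational, (2) p.278; Balaban1988Convergent, p.255, (2.12) p.256] -/
def regMSCoPOfRecord (ν : Stage7Numerics) (K k : ℕ) (Ω : ℕ → Set (Site (F.P K) 0)) : Set (GaugeField (F.P K) 0 (SU N)) :=
  regMSCoPOfRecordAt F N ν K k (suppDomOfRecord F ν K Ω) Ω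

/-- Membership in the class on a support (definitional). [cite: Balaban1985Variational, (2) p.278 (bookkeeping)] -/
theorem mem_regMSCoPOfRecordAt_iff (ν : Stage7Numerics) (K k : ℕ) (Ω₀ : Set (Site (F.P K) 0)) (Ω : ℕ → Set (Site (F.P K) 0))
    (U : GaugeField (F.P K) 0 (SU N)) :
    U ∈ regMSCoPOfRecordAt F N ν K k Ω₀ Ω ↔
      (∀ j, j ≤ k → PlaqSmallOn (B8Eq17ClassAkV1.plaqsOf (topSeq Ω₀ Ω j)) (ν.εreg * (F.P K).eta j ^ 2) U) ∧
        (∀ j, j ≤ k → Sect2.CoDivSmallOn (bondsOf (topSeq Ω₀ Ω j)) (ν.εreg * (F.P K).eta j ^ 3) U) := Iff.rfl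

/-- The displayed form (definitional). [cite: Balaban1985Variational, (2) p.278 (bookkeeping)] -/
theorem regMSCoPOfRecordAt_eq_setOf (ν : Stage7Numerics) (K k : ℕ) (Ω₀ : Set (Site (F.P K) 0)) (Ω : ℕ → Set (Site (F.P K) 0)) :
    regMSCoPOfRecordAt F N ν K k Ω₀ Ω =
      {U | (∀ j, j ≤ k → PlaqSmallOn (B8Eq17ClassAkV1.plaqsOf (topSeq Ω₀ Ω j)) (ν.εreg * (F.P K).eta j ^ 2) U) ∧
        (∀ j, j ≤ k → Sect2.CoDivSmallOn (bondsOf (topSeq Ω₀ Ω j)) (ν.εreg * (F.P K).eta j ^ 3) U)} := rfl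

/-- The class on a support is the (1.7)-part cut by the (1.9)-part (definitional). [cite: Balaban1985RegularSpaces, (1.7),(1.9) p.77 (bookkeeping)] -/
theorem regMSCoPOfRecordAt_eq_inter (ν : Stage7Numerics) (K k : ℕ) (Ω₀ : Set (Site (F.P K) 0)) (Ω : ℕ → Set (Site (F.P K) 0)) :
    regMSCoPOfRecordAt F N ν K k Ω₀ Ω =
      {U | ∀ j, j ≤ k → PlaqSmallOn (B8Eq17ClassAkV1.plaqsOf (topSeq Ω₀ Ω j)) (ν.εreg * (F.P K).eta j ^ 2) U} ∩
        {U | ∀ j, j ≤ k → Sect2.CoDivSmallOn (bondsOf (topSeq Ω₀ Ω j)) (ν.εreg * (F.P K).eta j ^ 3) U} := rfl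

/-- The class of record is the class on the support of record (definitional). [cite: Balaban1988Convergent, p.255 (bookkeeping)] -/
theorem regMSCoPOfRecord_eq_At (ν : Stage7Numerics) (K k : ℕ) (Ω : ℕ → Set (Site (F.P K) 0)) :
    regMSCoPOfRecord F N ν K k Ω = regMSCoPOfRecordAt F N ν K k (suppDomOfRecord F ν K Ω) Ω := rfl

/-- Membership in the class of record (definitional). [cite: Balaban1985Variational, (2) p.278 (bookkeeping)] -/
theorem mem_regMSCoPOfRecord_iff (ν : Stage7Numerics) (K k : ℕ) (Ω : ℕ → Set (Site (F.P K) 0)) (U : GaugeField (F.P K) 0 (SU N)) :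
    U ∈ regMSCoPOfRecord F N ν K k Ω ↔
      (∀ j, j ≤ k → PlaqSmallOn (B8Eq17ClassAkV1.plaqsOf (topSeq (suppDomOfRecord F ν K Ω) Ω j)) (ν.εreg * (F.P K).eta j ^ 2) U) ∧
        (∀ j, j ≤ k → Sect2.CoDivSmallOn (bondsOf (topSeq (suppDomOfRecord F ν K Ω) Ω j)) (ν.εreg * (F.P K).eta j ^ 3) U) := Iff.rfl

/-- The displayed form of the class of record (definitional). [cite: Balaban1985Variational, (2) p.278 (bookkeeping)] -/
theorem regMSCoPOfRecord_eq_setOf (ν : Stage7Numerics) (K k : ℕ) (Ω : ℕ → Set (Site (F.P K) 0)) :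
    regMSCoPOfRecord F N ν K k Ω =
      {U | (∀ j, j ≤ k → PlaqSmallOn (B8Eq17ClassAkV1.plaqsOf (topSeq (suppDomOfRecord F ν K Ω) Ω j)) (ν.εreg * (F.P K).eta j ^ 2) U) ∧
        (∀ j, j ≤ k → Sect2.CoDivSmallOn (bondsOf (topSeq (suppDomOfRecord F ν K Ω) Ω j)) (ν.εreg * (F.P K).eta j ^ 3) U)} := rfl

/-- The class of record is its (1.7)-part cut by its (1.9)-part (definitional). [cite: Balaban1985RegularSpaces, (1.7),(1.9) p.77 (bookkeeping)] -/
theorem regMSCoPOfRecord_eq_inter (ν : Stage7Numerics) (K k : ℕ) (Ω : ℕ → Set (Site (F.P K) 0)) :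
    regMSCoPOfRecord F N ν K k Ω =
      {U | ∀ j, j ≤ k → PlaqSmallOn (B8Eq17ClassAkV1.plaqsOf (topSeq (suppDomOfRecord F ν K Ω) Ω j)) (ν.εreg * (F.P K).eta j ^ 2) U} ∩
        {U | ∀ j, j ≤ k → Sect2.CoDivSmallOn (bondsOf (topSeq (suppDomOfRecord F ν K Ω) Ω j)) (ν.εreg * (F.P K).eta j ^ 3) U} := rfl

variable {F N}

/-- A member satisfies (1.7) at every scale `j ≤ k` on the plaquettes of `Ω_j` (`Ω₀` the support). [cite: Balaban1985RegularSpaces, (1.7) p.77] -/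
theorem plaqSmallOn_topSeq_of_mem_regMSCoPOfRecordAt {ν : Stage7Numerics} {K k : ℕ} {Ω₀ : Set (Site (F.P K) 0)} {Ω : ℕ → Set (Site (F.P K) 0)}
    {U : GaugeField (F.P K) 0 (SU N)} (hU : U ∈ regMSCoPOfRecordAt F N ν K k Ω₀ Ω) {j : ℕ} (hjk : j ≤ k) :
    PlaqSmallOn (B8Eq17ClassAkV1.plaqsOf (topSeq Ω₀ Ω j)) (ν.εreg * (F.P K).eta j ^ 2) U :=
  hU.1 j hjk

/-- A member satisfies (1.9) at every scale `j ≤ k` on the bonds of `Ω_j` (`Ω₀` the support). [cite: Balaban1985RegularSpaces, (1.9) p.77] -/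
theorem coDivSmallOn_of_mem_regMSCoPOfRecordAt {ν : Stage7Numerics} {K k : ℕ} {Ω₀ : Set (Site (F.P K) 0)} {Ω : ℕ → Set (Site (F.P K) 0)}
    {U : GaugeField (F.P K) 0 (SU N)} (hU : U ∈ regMSCoPOfRecordAt F N ν K k Ω₀ Ω) {j : ℕ} (hjk : j ≤ k) :
    Sect2.CoDivSmallOn (bondsOf (topSeq Ω₀ Ω j)) (ν.εreg * (F.P K).eta j ^ 3) U :=
  hU.2 j hjk

/-- The scale-`0` plaquette clause: (1.7) on the plaquettes of the support `Ω₀` ONLY. [cite: Balaban1985Variational, (2) p.278 (j = 0); Balaban1988Convergent, p.255] -/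
theorem plaqSmallOn_top_of_mem_regMSCoPOfRecordAt {ν : Stage7Numerics} {K k : ℕ} {Ω₀ : Set (Site (F.P K) 0)} {Ω : ℕ → Set (Site (F.P K) 0)}
    {U : GaugeField (F.P K) 0 (SU N)} (hU : U ∈ regMSCoPOfRecordAt F N ν K k Ω₀ Ω) :
    PlaqSmallOn (B8Eq17ClassAkV1.plaqsOf Ω₀) (ν.εreg * (F.P K).eta 0 ^ 2) U :=
  hU.1 0 (Nat.zero_le k)

/-- The scale-`0` co-divergence clause: (1.9) on the bonds of the support `Ω₀` ONLY. [cite: Balaban1985Variational, (2) p.278 (j = 0); Balaban1988Convergent, p.255] -/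
theorem coDivSmallOn_top_of_mem_regMSCoPOfRecordAt {ν : Stage7Numerics} {K k : ℕ} {Ω₀ : Set (Site (F.P K) 0)} {Ω : ℕ → Set (Site (F.P K) 0)}
    {U : GaugeField (F.P K) 0 (SU N)} (hU : U ∈ regMSCoPOfRecordAt F N ν K k Ω₀ Ω) :
    Sect2.CoDivSmallOn (bondsOf Ω₀) (ν.εreg * (F.P K).eta 0 ^ 3) U :=
  hU.2 0 (Nat.zero_le k)

/-- A positive scale `1 ≤ j ≤ k`: (1.7) on the plaquettes meeting `Ω_j` (FILE 16's range). [cite: Balaban1985RegularSpaces, (1.7) p.77] -/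
theorem plaqSmallOn_of_mem_regMSCoPOfRecordAt {ν : Stage7Numerics} {K k : ℕ} {Ω₀ : Set (Site (F.P K) 0)} {Ω : ℕ → Set (Site (F.P K) 0)}
    {U : GaugeField (F.P K) 0 (SU N)} (hU : U ∈ regMSCoPOfRecordAt F N ν K k Ω₀ Ω) {j : ℕ} (hj : 1 ≤ j) (hjk : j ≤ k) :
    PlaqSmallOn (B8Eq17ClassAkV1.plaqsOf (Ω j)) (ν.εreg * (F.P K).eta j ^ 2) U := by
  have h := hU.1 j hjk
  rwa [topSeq_of_ne_zero _ _ (Nat.one_le_iff_ne_zero.mp hj)] at h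

/-- A positive scale `1 ≤ j ≤ k`: (1.9) on r12's `bondsOf (Ω j)` (node00-def-P11's range). [cite: Balaban1985RegularSpaces, (1.9) p.77] -/
theorem coDivSmallOn_bondsOf_of_mem_regMSCoPOfRecordAt {ν : Stage7Numerics} {K k : ℕ} {Ω₀ : Set (Site (F.P K) 0)} {Ω : ℕ → Set (Site (F.P K) 0)}
    {U : GaugeField (F.P K) 0 (SU N)} (hU : U ∈ regMSCoPOfRecordAt F N ν K k Ω₀ Ω) {j : ℕ} (hj : 1 ≤ j) (hjk : j ≤ k) :
    Sect2.CoDivSmallOn (bondsOf (Ω j)) (ν.εreg * (F.P K).eta j ^ 3) U := by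
  have h := hU.2 j hjk
  rwa [topSeq_of_ne_zero _ _ (Nat.one_le_iff_ne_zero.mp hj)] at h

/-- Conversely, the two families of clauses give membership. [cite: Balaban1985Variational, (2) p.278 (bookkeeping)] -/
theorem mem_regMSCoPOfRecordAt_of {ν : Stage7Numerics} {K k : ℕ} {Ω₀ : Set (Site (F.P K) 0)} {Ω : ℕ → Set (Site (F.P K) 0)}
    {U : GaugeField (F.P K) 0 (SU N)}
    (h7 : ∀ j, j ≤ k → PlaqSmallOn (B8Eq17ClassAkV1.plaqsOf (topSeq Ω₀ Ω j)) (ν.εreg * (F.P K).eta j ^ 2) U)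
    (h9 : ∀ j, j ≤ k → Sect2.CoDivSmallOn (bondsOf (topSeq Ω₀ Ω j)) (ν.εreg * (F.P K).eta j ^ 3) U) :
    U ∈ regMSCoPOfRecordAt F N ν K k Ω₀ Ω := ⟨h7, h9⟩

/-- **THE CLASS IS ANTITONE IN THE SUPPORT**: a larger scale-`0` domain imposes more clauses. [cite: Balaban1985Variational, (2) p.278 (bookkeeping)] -/
theorem regMSCoPOfRecordAt_anti (ν : Stage7Numerics) (K k : ℕ) {Ω₀ Ω₀' : Set (Site (F.P K) 0)} (h : Ω₀ ⊆ Ω₀') (Ω : ℕ → Set (Site (F.P K) 0)) :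
    regMSCoPOfRecordAt F N ν K k Ω₀' Ω ⊆ regMSCoPOfRecordAt F N ν K k Ω₀ Ω := fun _ hU =>
  ⟨fun j hjk p hp => hU.1 j hjk p (B8Eq17ClassAkV1.plaqsOf_mono (topSeq_mono_top h Ω j) hp),
    fun j hjk => (hU.2 j hjk).mono fun b hb => by
      rcases hb with hb | hb
      exacts [Or.inl (topSeq_mono_top h Ω j hb), Or.inr (topSeq_mono_top h Ω j hb)]⟩

/-- **WITH `Ω₀ = T_η` THE CLASS IS FILE 22's** `regMSCoOfRecord` (the small-field papers' reading [6] (1.3), print-stronger than [15] (2) on a support).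
[cite: Balaban1985RegularSpaces, (1.3),(1.7),(1.9) p.77; Balaban1985Variational, (2) p.278] -/
theorem regMSCoPOfRecordAt_univ (ν : Stage7Numerics) (K k : ℕ) (Ω : ℕ → Set (Site (F.P K) 0)) :
    regMSCoPOfRecordAt F N ν K k Set.univ Ω = regMSCoOfRecord F N ν K k Ω := by
  ext U
  refine ⟨fun h => ⟨fun j hj => ?_, ?_⟩, fun h => ⟨fun j hj => ?_, fun j hj => ?_⟩⟩
  · simpa only [plaqsOf_topSeq_univ] using h.1 j hj
  · intro j hj
    simpa only [bondsOf_topSeq_univ] using h.2 j hj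
  · simpa only [plaqsOf_topSeq_univ] using h.1 j hj
  · simpa only [bondsOf_topSeq_univ] using h.2 j hj

/-- **FILE 22's CLASS LIES INSIDE THE CLASS ON ANY SUPPORT** (it is the case `Ω₀ = T_η`, and the class is antitone in `Ω₀`).
[cite: Balaban1985RegularSpaces, (1.3),(1.7),(1.9) p.77; Balaban1985Variational, (2) p.278] -/
theorem regMSCoOfRecord_subset_regMSCoPOfRecordAt (ν : Stage7Numerics) (K k : ℕ) (Ω₀ : Set (Site (F.P K) 0)) (Ω : ℕ → Set (Site (F.P K) 0)) :
    regMSCoOfRecord F N ν K k Ω ⊆ regMSCoPOfRecordAt F N ν K k Ω₀ Ω := by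
  rw [← regMSCoPOfRecordAt_univ ν K k Ω]
  exact regMSCoPOfRecordAt_anti ν K k (Set.subset_univ Ω₀) Ω

/-- In particular FILE 22's class lies inside the class of record. [cite: Balaban1985Variational, (2) p.278; Balaban1988Convergent, p.255] -/
theorem regMSCoOfRecord_subset_regMSCoPOfRecord (ν : Stage7Numerics) (K k : ℕ) (Ω : ℕ → Set (Site (F.P K) 0)) :
    regMSCoOfRecord F N ν K k Ω ⊆ regMSCoPOfRecord F N ν K k Ω :=
  regMSCoOfRecord_subset_regMSCoPOfRecordAt ν K k _ Ω

/-- Class-of-record membership: (1.7) at every scale `j ≤ k`. [cite: Balaban1985RegularSpaces, (1.7) p.77] -/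
theorem plaqSmallOn_topSeq_of_mem_regMSCoPOfRecord {ν : Stage7Numerics} {K k : ℕ} {Ω : ℕ → Set (Site (F.P K) 0)} {U : GaugeField (F.P K) 0 (SU N)}
    (hU : U ∈ regMSCoPOfRecord F N ν K k Ω) {j : ℕ} (hjk : j ≤ k) :
    PlaqSmallOn (B8Eq17ClassAkV1.plaqsOf (topSeq (suppDomOfRecord F ν K Ω) Ω j)) (ν.εreg * (F.P K).eta j ^ 2) U :=
  hU.1 j hjk

/-- Class-of-record membership: (1.9) at every scale `j ≤ k`. [cite: Balaban1985RegularSpaces, (1.9) p.77] -/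
theorem coDivSmallOn_of_mem_regMSCoPOfRecord {ν : Stage7Numerics} {K k : ℕ} {Ω : ℕ → Set (Site (F.P K) 0)} {U : GaugeField (F.P K) 0 (SU N)}
    (hU : U ∈ regMSCoPOfRecord F N ν K k Ω) {j : ℕ} (hjk : j ≤ k) :
    Sect2.CoDivSmallOn (bondsOf (topSeq (suppDomOfRecord F ν K Ω) Ω j)) (ν.εreg * (F.P K).eta j ^ 3) U :=
  hU.2 j hjk

/-- Class-of-record membership, scale `0`: (1.7) on the plaquettes of the SUPPORT of record. [cite: Balaban1985Variational, (2) p.278 (j = 0); Balaban1988Convergent, p.255] -/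
theorem plaqSmallOn_supp_of_mem_regMSCoPOfRecord {ν : Stage7Numerics} {K k : ℕ} {Ω : ℕ → Set (Site (F.P K) 0)} {U : GaugeField (F.P K) 0 (SU N)}
    (hU : U ∈ regMSCoPOfRecord F N ν K k Ω) :
    PlaqSmallOn (B8Eq17ClassAkV1.plaqsOf (suppDomOfRecord F ν K Ω)) (ν.εreg * (F.P K).eta 0 ^ 2) U :=
  hU.1 0 (Nat.zero_le k)

/-- Class-of-record membership, scale `0`: (1.9) on the bonds of the SUPPORT of record. [cite: Balaban1985Variational, (2) p.278 (j = 0); Balaban1988Convergent, p.255] -/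
theorem coDivSmallOn_supp_of_mem_regMSCoPOfRecord {ν : Stage7Numerics} {K k : ℕ} {Ω : ℕ → Set (Site (F.P K) 0)} {U : GaugeField (F.P K) 0 (SU N)}
    (hU : U ∈ regMSCoPOfRecord F N ν K k Ω) :
    Sect2.CoDivSmallOn (bondsOf (suppDomOfRecord F ν K Ω)) (ν.εreg * (F.P K).eta 0 ^ 3) U :=
  hU.2 0 (Nat.zero_le k)

/-- Class-of-record membership, scale `1 ≤ j ≤ k`: (1.7) on the plaquettes meeting `Ω_j` (FILE 16's range). [cite: Balaban1985RegularSpaces, (1.7) p.77] -/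
theorem plaqSmallOn_of_mem_regMSCoPOfRecord {ν : Stage7Numerics} {K k : ℕ} {Ω : ℕ → Set (Site (F.P K) 0)}
    {U : GaugeField (F.P K) 0 (SU N)} (hU : U ∈ regMSCoPOfRecord F N ν K k Ω) {j : ℕ} (hj : 1 ≤ j) (hjk : j ≤ k) :
    PlaqSmallOn (B8Eq17ClassAkV1.plaqsOf (Ω j)) (ν.εreg * (F.P K).eta j ^ 2) U :=
  plaqSmallOn_of_mem_regMSCoPOfRecordAt hU hj hjk

/-- Class-of-record membership, scale `1 ≤ j ≤ k`: (1.9) on r12's `bondsOf (Ω j)`. [cite: Balaban1985RegularSpaces, (1.9) p.77] -/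
theorem coDivSmallOn_bondsOf_of_mem_regMSCoPOfRecord {ν : Stage7Numerics} {K k : ℕ} {Ω : ℕ → Set (Site (F.P K) 0)}
    {U : GaugeField (F.P K) 0 (SU N)} (hU : U ∈ regMSCoPOfRecord F N ν K k Ω) {j : ℕ} (hj : 1 ≤ j) (hjk : j ≤ k) :
    Sect2.CoDivSmallOn (bondsOf (Ω j)) (ν.εreg * (F.P K).eta j ^ 3) U :=
  coDivSmallOn_bondsOf_of_mem_regMSCoPOfRecordAt hU hj hjk

variable (F N)

/-! ## §3  The (2.12) datum and the background of a sequence in the class on a support, of record -/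

/-- **The (2.12) datum on a support**: FILE 1's `bgOfRecord` along the averaging of record in the class `regMSCoPOfRecordAt … Ω₀ Ω`.
[cite: Balaban1988Convergent, (2.12)–(2.13) p.256–257; Balaban1985Variational, (6) p.278] -/
def bgMSCoPOfRecordAt (ν : Stage7Numerics) (K k : ℕ) (Ω₀ : Set (Site (F.P K) 0)) (Ω : ℕ → Set (Site (F.P K) 0)) :
    DetBackground (F.P K) (SU N) (avOfRecord F N K) :=
  bgOfRecord (avOfRecord F N K) (regMSCoPOfRecordAt F N ν K k Ω₀ Ω)

/-- **The (2.12) datum of record** (FILE 22's arity): the datum on the support of record. [cite: Balaban1988Convergent, (2.12) p.256, p.255] -/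
def bgMSCoPOfRecord (ν : Stage7Numerics) (K k : ℕ) (Ω : ℕ → Set (Site (F.P K) 0)) : DetBackground (F.P K) (SU N) (avOfRecord F N K) :=
  bgMSCoPOfRecordAt F N ν K k (suppDomOfRecord F ν K Ω) Ω

/-- Solution map of the datum on a support = FILE 1's `UminOfRecord` in that class (definitional). [cite: Balaban1988Convergent, (2.12) p.256 (bookkeeping)] -/
theorem bgMSCoPOfRecordAt_U (ν : Stage7Numerics) (K k : ℕ) (Ω₀ : Set (Site (F.P K) 0)) (Ω : ℕ → Set (Site (F.P K) 0)) :
    (bgMSCoPOfRecordAt F N ν K k Ω₀ Ω).U = UminOfRecord (avOfRecord F N K) (regMSCoPOfRecordAt F N ν K k Ω₀ Ω) := rfl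

/-- Domain of the datum on a support = FILE 1's solvable set in that class (definitional). [cite: Balaban1988Convergent, (2.12) p.256 (bookkeeping)] -/
theorem bgMSCoPOfRecordAt_dom (ν : Stage7Numerics) (K k : ℕ) (Ω₀ : Set (Site (F.P K) 0)) (Ω : ℕ → Set (Site (F.P K) 0)) :
    (bgMSCoPOfRecordAt F N ν K k Ω₀ Ω).dom = solvableDom (avOfRecord F N K) (regMSCoPOfRecordAt F N ν K k Ω₀ Ω) := rfl

/-- Class of the datum on a support (definitional). [cite: Balaban1985Variational, (6) p.278 (bookkeeping)] -/
theorem bgMSCoPOfRecordAt_reg (ν : Stage7Numerics) (K k : ℕ) (Ω₀ : Set (Site (F.P K) 0)) (Ω : ℕ → Set (Site (F.P K) 0)) :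
    (bgMSCoPOfRecordAt F N ν K k Ω₀ Ω).reg = regMSCoPOfRecordAt F N ν K k Ω₀ Ω := rfl

/-- The datum of record is the datum on the support of record (definitional). [cite: Balaban1988Convergent, p.255 (bookkeeping)] -/
theorem bgMSCoPOfRecord_eq_At (ν : Stage7Numerics) (K k : ℕ) (Ω : ℕ → Set (Site (F.P K) 0)) :
    bgMSCoPOfRecord F N ν K k Ω = bgMSCoPOfRecordAt F N ν K k (suppDomOfRecord F ν K Ω) Ω := rfl

/-- Solution map of the datum of record (definitional). [cite: Balaban1988Convergent, (2.12) p.256 (bookkeeping)] -/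
theorem bgMSCoPOfRecord_U (ν : Stage7Numerics) (K k : ℕ) (Ω : ℕ → Set (Site (F.P K) 0)) :
    (bgMSCoPOfRecord F N ν K k Ω).U = UminOfRecord (avOfRecord F N K) (regMSCoPOfRecord F N ν K k Ω) := rfl

/-- Domain of the datum of record (definitional). [cite: Balaban1988Convergent, (2.12) p.256 (bookkeeping)] -/
theorem bgMSCoPOfRecord_dom (ν : Stage7Numerics) (K k : ℕ) (Ω : ℕ → Set (Site (F.P K) 0)) :
    (bgMSCoPOfRecord F N ν K k Ω).dom = solvableDom (avOfRecord F N K) (regMSCoPOfRecord F N ν K k Ω) := rfl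

/-- Class of the datum of record (definitional). [cite: Balaban1985Variational, (6) p.278 (bookkeeping)] -/
theorem bgMSCoPOfRecord_reg (ν : Stage7Numerics) (K k : ℕ) (Ω : ℕ → Set (Site (F.P K) 0)) :
    (bgMSCoPOfRecord F N ν K k Ω).reg = regMSCoPOfRecord F N ν K k Ω := rfl

/-- **THE BACKGROUND OF A SEQUENCE ON A SUPPORT** — `U_k(s)(𝐖) = U_k(V)`, a minimal configuration of (5) on (6) with the class posed on the support
`Ω₀`: r11's `B14.Eq218Concrete.Ubg` at the datum `bgMSCoPOfRecordAt … Ω₀ s.Ω`.  TOTAL (junk `1` off the solvable set); [15] Thm 1 NOT asserted.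
[cite: Balaban1985Variational, (5)–(6) p.278, Thm 1 (8) p.279; Balaban1988Convergent, (2.12)–(2.13) p.256–257, p.255] -/
def UbgMSCoPOfRecordAt (ν : Stage7Numerics) (M : ℕ) (g : ℕ → ℝ) (K k : ℕ) (Ω₀ : Set (Site (F.P K) 0)) (s : SeqOfRecord F ν M g K k) :
    MSField (F.P K) (SU N) → GaugeField (F.P K) 0 (SU N) :=
  B14.Eq218Concrete.Ubg (bgMSCoPOfRecordAt F N ν K k Ω₀ s.Ω) k s

/-- **THE BACKGROUND FIELD OF A SEQUENCE, OF RECORD — SUPPORT EDITION** (FILE 22's arity): r11's `Ubg` at the datum of record `bgMSCoPOfRecord … s.Ω`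
(class posed on the support of record `Ω₀(s) = suppDomOfRecord ν K s.Ω`).  TOTAL (junk `1` off the solvable set); [15] Thm 1 NOT asserted.
[cite: Balaban1985Variational, (5)–(6) p.278, Thm 1 (8) p.279; Balaban1988Convergent, (2.12)–(2.13) p.256–257, p.255] -/
def UbgMSCoPOfRecord (ν : Stage7Numerics) (M : ℕ) (g : ℕ → ℝ) (K k : ℕ) (s : SeqOfRecord F ν M g K k) :
    MSField (F.P K) (SU N) → GaugeField (F.P K) 0 (SU N) :=
  B14.Eq218Concrete.Ubg (bgMSCoPOfRecord F N ν K k s.Ω) k s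

variable {F N}

/-- Unfolding to FILE 1's solution map on `genSet s.Ω k` in the class on a support (definitional). [cite: Balaban1988Convergent, (2.13) p.257] -/
theorem UbgMSCoPOfRecordAt_apply (ν : Stage7Numerics) (M : ℕ) (g : ℕ → ℝ) (K k : ℕ) (Ω₀ : Set (Site (F.P K) 0)) (s : SeqOfRecord F ν M g K k)
    (W : MSField (F.P K) (SU N)) :
    UbgMSCoPOfRecordAt F N ν M g K k Ω₀ s W = UminOfRecord (avOfRecord F N K) (regMSCoPOfRecordAt F N ν K k Ω₀ s.Ω) (genSet s.Ω k) W := rfl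

/-- The background of record is the background on the support of record (definitional). [cite: Balaban1988Convergent, p.255 (bookkeeping)] -/
theorem UbgMSCoPOfRecord_eq_At (ν : Stage7Numerics) (M : ℕ) (g : ℕ → ℝ) (K k : ℕ) (s : SeqOfRecord F ν M g K k) :
    UbgMSCoPOfRecord F N ν M g K k s = UbgMSCoPOfRecordAt F N ν M g K k (suppDomOfRecord F ν K s.Ω) s := rfl

/-- Unfolding to FILE 1's solution map on `𝔅({Ω_j(s)}) = genSet s.Ω k` in the class of record (definitional). [cite: Balaban1988Convergent, (2.13) p.257] -/
theorem UbgMSCoPOfRecord_apply (ν : Stage7Numerics) (M : ℕ) (g : ℕ → ℝ) (K k : ℕ) (s : SeqOfRecord F ν M g K k) (W : MSField (F.P K) (SU N)) :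
    UbgMSCoPOfRecord F N ν M g K k s W = UminOfRecord (avOfRecord F N K) (regMSCoPOfRecord F N ν K k s.Ω) (genSet s.Ω k) W := rfl

/-- It is r11's `Ubg` at the datum of record (definitional). [cite: Balaban1988Convergent, §2 p.258] -/
theorem UbgMSCoPOfRecord_eq_Ubg (ν : Stage7Numerics) (M : ℕ) (g : ℕ → ℝ) (K k : ℕ) (s : SeqOfRecord F ν M g K k) :
    UbgMSCoPOfRecord F N ν M g K k s = B14.Eq218Concrete.Ubg (bgMSCoPOfRecord F N ν K k s.Ω) k s := rfl

/-- **THE CHARACTERISING PROPERTY on the solvable set, on a support**: `U_k(s)(𝐖)` IS a minimal configuration of (5) on (6).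
[cite: Balaban1985Variational, (5)–(6) p.278; Balaban1988Convergent, (2.12) p.256] -/
theorem isMinimizer_UbgMSCoPOfRecordAt (ν : Stage7Numerics) (M : ℕ) (g : ℕ → ℝ) (K k : ℕ) (Ω₀ : Set (Site (F.P K) 0)) (s : SeqOfRecord F ν M g K k)
    {W : MSField (F.P K) (SU N)} (hW : W ∈ solvableDom (avOfRecord F N K) (regMSCoPOfRecordAt F N ν K k Ω₀ s.Ω) (genSet s.Ω k)) :
    IsMinimizer (avOfRecord F N K) (regMSCoPOfRecordAt F N ν K k Ω₀ s.Ω) (genSet s.Ω k) W (UbgMSCoPOfRecordAt F N ν M g K k Ω₀ s W) :=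
  B14.Eq218Concrete.isMinimizer_Ubg (bgMSCoPOfRecordAt F N ν K k Ω₀ s.Ω) k s hW

/-- **THE CHARACTERISING PROPERTY on the solvable set, of record**: `U_k(s)(𝐖)` IS a minimal configuration of (5) on (6) for `𝔅({Ω_j(s)})` and `𝐖`.
[cite: Balaban1985Variational, (5)–(6) p.278; Balaban1988Convergent, (2.12) p.256] -/
theorem isMinimizer_UbgMSCoPOfRecord (ν : Stage7Numerics) (M : ℕ) (g : ℕ → ℝ) (K k : ℕ) (s : SeqOfRecord F ν M g K k)
    {W : MSField (F.P K) (SU N)} (hW : W ∈ solvableDom (avOfRecord F N K) (regMSCoPOfRecord F N ν K k s.Ω) (genSet s.Ω k)) :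
    IsMinimizer (avOfRecord F N K) (regMSCoPOfRecord F N ν K k s.Ω) (genSet s.Ω k) W (UbgMSCoPOfRecord F N ν M g K k s W) :=
  B14.Eq218Concrete.isMinimizer_Ubg (bgMSCoPOfRecord F N ν K k s.Ω) k s hW

/-- The same characterising property with the class DISPLAYED as the explicit set of [15] (2) ∧ (6) (definitional unfolding of `regMSCoPOfRecord`).
[cite: Balaban1985Variational, (2),(6) p.278 (bookkeeping)] -/
theorem isMinimizer_setOf_UbgMSCoPOfRecord (ν : Stage7Numerics) (M : ℕ) (g : ℕ → ℝ) (K k : ℕ) (s : SeqOfRecord F ν M g K k)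
    {W : MSField (F.P K) (SU N)} (hW : W ∈ solvableDom (avOfRecord F N K) (regMSCoPOfRecord F N ν K k s.Ω) (genSet s.Ω k)) :
    IsMinimizer (avOfRecord F N K)
      {U | (∀ j, j ≤ k → PlaqSmallOn (B8Eq17ClassAkV1.plaqsOf (topSeq (suppDomOfRecord F ν K s.Ω) s.Ω j)) (ν.εreg * (F.P K).eta j ^ 2) U) ∧
        (∀ j, j ≤ k → Sect2.CoDivSmallOn (bondsOf (topSeq (suppDomOfRecord F ν K s.Ω) s.Ω j)) (ν.εreg * (F.P K).eta j ^ 3) U)}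
      (genSet s.Ω k) W (UbgMSCoPOfRecord F N ν M g K k s W) :=
  isMinimizer_UbgMSCoPOfRecord ν M g K k s hW

/-- The solvable set with the class displayed explicitly is the solvable set of record (definitional). [cite: Balaban1985Variational, (6),(8) p.278–279 (bookkeeping)] -/
theorem solvableDom_setOf_eq_regMSCoP (ν : Stage7Numerics) (K k : ℕ) (Ω : ℕ → Set (Site (F.P K) 0)) :
    solvableDom (avOfRecord F N K)
      {U | (∀ j, j ≤ k → PlaqSmallOn (B8Eq17ClassAkV1.plaqsOf (topSeq (suppDomOfRecord F ν K Ω) Ω j)) (ν.εreg * (F.P K).eta j ^ 2) U) ∧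
        (∀ j, j ≤ k → Sect2.CoDivSmallOn (bondsOf (topSeq (suppDomOfRecord F ν K Ω) Ω j)) (ν.εreg * (F.P K).eta j ^ 3) U)} (genSet Ω k) =
      solvableDom (avOfRecord F N K) (regMSCoPOfRecord F N ν K k Ω) (genSet Ω k) := rfl

/-- On the solvable set `U_k(s)(𝐖)` lies in the class on the support. [cite: Balaban1985Variational, (2),(6) p.278] -/
theorem UbgMSCoPOfRecordAt_mem_reg (ν : Stage7Numerics) (M : ℕ) (g : ℕ → ℝ) (K k : ℕ) (Ω₀ : Set (Site (F.P K) 0)) (s : SeqOfRecord F ν M g K k)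
    {W : MSField (F.P K) (SU N)} (hW : W ∈ solvableDom (avOfRecord F N K) (regMSCoPOfRecordAt F N ν K k Ω₀ s.Ω) (genSet s.Ω k)) :
    UbgMSCoPOfRecordAt F N ν M g K k Ω₀ s W ∈ regMSCoPOfRecordAt F N ν K k Ω₀ s.Ω :=
  (isMinimizer_UbgMSCoPOfRecordAt ν M g K k Ω₀ s hW).1

/-- On the solvable set `U_k(s)(𝐖)` lies in the class of record. [cite: Balaban1985Variational, (2),(6) p.278] -/
theorem UbgMSCoPOfRecord_mem_reg (ν : Stage7Numerics) (M : ℕ) (g : ℕ → ℝ) (K k : ℕ) (s : SeqOfRecord F ν M g K k)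
    {W : MSField (F.P K) (SU N)} (hW : W ∈ solvableDom (avOfRecord F N K) (regMSCoPOfRecord F N ν K k s.Ω) (genSet s.Ω k)) :
    UbgMSCoPOfRecord F N ν M g K k s W ∈ regMSCoPOfRecord F N ν K k s.Ω :=
  (isMinimizer_UbgMSCoPOfRecord ν M g K k s hW).1

/-- On the solvable set: (1.7) at the minimiser at every scale `j ≤ k`, on the plaquettes of `Ω_j(s)` (`Ω₀(s)` the support of record).
[cite: Balaban1985RegularSpaces, (1.7) p.77; Balaban1985Variational, (2),(6) p.278] -/
theorem plaqSmallOn_topSeq_UbgMSCoPOfRecord (ν : Stage7Numerics) (M : ℕ) (g : ℕ → ℝ) (K k : ℕ) (s : SeqOfRecord F ν M g K k)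
    {W : MSField (F.P K) (SU N)} (hW : W ∈ solvableDom (avOfRecord F N K) (regMSCoPOfRecord F N ν K k s.Ω) (genSet s.Ω k))
    {j : ℕ} (hjk : j ≤ k) :
    PlaqSmallOn (B8Eq17ClassAkV1.plaqsOf (topSeq (suppDomOfRecord F ν K s.Ω) s.Ω j)) (ν.εreg * (F.P K).eta j ^ 2)
      (UbgMSCoPOfRecord F N ν M g K k s W) :=
  (UbgMSCoPOfRecord_mem_reg ν M g K k s hW).1 j hjk

/-- On the solvable set: (1.7) at the minimiser, scale `0` — on the plaquettes of the SUPPORT of record (not globally).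
[cite: Balaban1985Variational, (2) p.278 (j = 0); Balaban1988Convergent, p.255] -/
theorem plaqSmallOn_supp_UbgMSCoPOfRecord (ν : Stage7Numerics) (M : ℕ) (g : ℕ → ℝ) (K k : ℕ) (s : SeqOfRecord F ν M g K k)
    {W : MSField (F.P K) (SU N)} (hW : W ∈ solvableDom (avOfRecord F N K) (regMSCoPOfRecord F N ν K k s.Ω) (genSet s.Ω k)) :
    PlaqSmallOn (B8Eq17ClassAkV1.plaqsOf (suppDomOfRecord F ν K s.Ω)) (ν.εreg * (F.P K).eta 0 ^ 2) (UbgMSCoPOfRecord F N ν M g K k s W) :=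
  (UbgMSCoPOfRecord_mem_reg ν M g K k s hW).1 0 (Nat.zero_le k)

/-- On the solvable set: (1.7) at the minimiser, scale `1 ≤ j ≤ k` — the plaquettes meeting `Ω_j(s)` (FILE 22's face, token for token).
[cite: Balaban1985RegularSpaces, (1.7) p.77; Balaban1985Variational, (6),(8) p.278–279] -/
theorem plaqSmallOn_UbgMSCoPOfRecord (ν : Stage7Numerics) (M : ℕ) (g : ℕ → ℝ) (K k : ℕ) (s : SeqOfRecord F ν M g K k)
    {W : MSField (F.P K) (SU N)} (hW : W ∈ solvableDom (avOfRecord F N K) (regMSCoPOfRecord F N ν K k s.Ω) (genSet s.Ω k))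
    {j : ℕ} (hj : 1 ≤ j) (hjk : j ≤ k) :
    PlaqSmallOn (B8Eq17ClassAkV1.plaqsOf (s.Ω j)) (ν.εreg * (F.P K).eta j ^ 2) (UbgMSCoPOfRecord F N ν M g K k s W) :=
  plaqSmallOn_of_mem_regMSCoPOfRecord (UbgMSCoPOfRecord_mem_reg ν M g K k s hW) hj hjk

/-- On the solvable set: (1.9) at the minimiser at every scale `j ≤ k`, on the bonds of `Ω_j(s)` (`Ω₀(s)` the support of record) — (1.9) AT THE
MINIMISER BY MEMBERSHIP (director-ym №149 (5)), support edition. [cite: Balaban1985RegularSpaces, (1.9) p.77; Balaban1985Variational, (2),(6) p.278] -/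
theorem coDivSmallOn_UbgMSCoPOfRecord (ν : Stage7Numerics) (M : ℕ) (g : ℕ → ℝ) (K k : ℕ) (s : SeqOfRecord F ν M g K k)
    {W : MSField (F.P K) (SU N)} (hW : W ∈ solvableDom (avOfRecord F N K) (regMSCoPOfRecord F N ν K k s.Ω) (genSet s.Ω k))
    {j : ℕ} (hjk : j ≤ k) :
    Sect2.CoDivSmallOn (bondsOf (topSeq (suppDomOfRecord F ν K s.Ω) s.Ω j)) (ν.εreg * (F.P K).eta j ^ 3) (UbgMSCoPOfRecord F N ν M g K k s W) :=
  (UbgMSCoPOfRecord_mem_reg ν M g K k s hW).2 j hjk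

/-- On the solvable set: (1.9) at the minimiser, scale `0` — on the bonds of the SUPPORT of record (not globally).
[cite: Balaban1985Variational, (2) p.278 (j = 0); Balaban1988Convergent, p.255] -/
theorem coDivSmallOn_supp_UbgMSCoPOfRecord (ν : Stage7Numerics) (M : ℕ) (g : ℕ → ℝ) (K k : ℕ) (s : SeqOfRecord F ν M g K k)
    {W : MSField (F.P K) (SU N)} (hW : W ∈ solvableDom (avOfRecord F N K) (regMSCoPOfRecord F N ν K k s.Ω) (genSet s.Ω k)) :
    Sect2.CoDivSmallOn (bondsOf (suppDomOfRecord F ν K s.Ω)) (ν.εreg * (F.P K).eta 0 ^ 3) (UbgMSCoPOfRecord F N ν M g K k s W) :=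
  (UbgMSCoPOfRecord_mem_reg ν M g K k s hW).2 0 (Nat.zero_le k)

/-- On the solvable set: (1.9) at the minimiser on r12's `bondsOf (s.Ω j)`, `1 ≤ j ≤ k` (FILE 22's face, token for token). [cite: Balaban1985RegularSpaces, (1.9) p.77] -/
theorem coDivSmallOn_bondsOf_UbgMSCoPOfRecord (ν : Stage7Numerics) (M : ℕ) (g : ℕ → ℝ) (K k : ℕ) (s : SeqOfRecord F ν M g K k)
    {W : MSField (F.P K) (SU N)} (hW : W ∈ solvableDom (avOfRecord F N K) (regMSCoPOfRecord F N ν K k s.Ω) (genSet s.Ω k))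
    {j : ℕ} (hj : 1 ≤ j) (hjk : j ≤ k) :
    Sect2.CoDivSmallOn (bondsOf (s.Ω j)) (ν.εreg * (F.P K).eta j ^ 3) (UbgMSCoPOfRecord F N ν M g K k s W) :=
  coDivSmallOn_bondsOf_of_mem_regMSCoPOfRecord (UbgMSCoPOfRecord_mem_reg ν M g K k s hW) hj hjk

/-- On the solvable set: THE WHOLE (1.9) FAMILY at the minimiser, `j = 0, …, k` — (1.9) AT THE MINIMISER BY MEMBERSHIP (director-ym №149 (5)),
support edition; FILE 22's `coDivClassOn_UbgMSCoOfRecord` token (there node00-def-P11's `Sect2.CoDivClassOn`, ranges `Sect2.omegaBonds` with the whole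
torus at scale `0`; here the displayed family on `bondsOf (topSeq Ω₀(s) s.Ω j)`, scale `0` = the bonds of the support).
[cite: Balaban1985RegularSpaces, (1.9) p.77; Balaban1985Variational, (2),(6) p.278; Balaban1988Convergent, p.255] -/
theorem coDivClassOn_UbgMSCoPOfRecord (ν : Stage7Numerics) (M : ℕ) (g : ℕ → ℝ) (K k : ℕ) (s : SeqOfRecord F ν M g K k)
    {W : MSField (F.P K) (SU N)} (hW : W ∈ solvableDom (avOfRecord F N K) (regMSCoPOfRecord F N ν K k s.Ω) (genSet s.Ω k)) :
    ∀ j, j ≤ k →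
      Sect2.CoDivSmallOn (bondsOf (topSeq (suppDomOfRecord F ν K s.Ω) s.Ω j)) (ν.εreg * (F.P K).eta j ^ 3) (UbgMSCoPOfRecord F N ν M g K k s W) :=
  (UbgMSCoPOfRecord_mem_reg ν M g K k s hW).2

/-- On the solvable set the averages of `U_k(s)(𝐖)` agree with `𝐖` on the determining set: `M_𝔅(U_k(s)(𝐖)) = 𝐖` — in particular «U = V₀ on Ω₁ᶜ»
((1.12), the scale-`0` constraint, UNCHANGED by the support edition). [cite: Balaban1985Variational, (3) p.278; Balaban1988Convergent, (2.11)–(2.12) p.256, (1.12) p.248] -/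
theorem agreeOn_UbgMSCoPOfRecord (ν : Stage7Numerics) (M : ℕ) (g : ℕ → ℝ) (K k : ℕ) (s : SeqOfRecord F ν M g K k)
    {W : MSField (F.P K) (SU N)} (hW : W ∈ solvableDom (avOfRecord F N K) (regMSCoPOfRecord F N ν K k s.Ω) (genSet s.Ω k)) :
    AgreeOn (genSet s.Ω k) (avgFamily (avOfRecord F N K) (UbgMSCoPOfRecord F N ν M g K k s W)) W :=
  (isMinimizer_UbgMSCoPOfRecord ν M g K k s hW).2.1

/-- On the solvable set `U_k(s)(𝐖)` minimises the Wilson action among the class-of-record configurations with the same averages.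
[cite: Balaban1985Variational, (5)–(6) p.278] -/
theorem wilsonAction4_UbgMSCoPOfRecord_le (ν : Stage7Numerics) (M : ℕ) (g : ℕ → ℝ) (K k : ℕ) (s : SeqOfRecord F ν M g K k)
    {W : MSField (F.P K) (SU N)} (hW : W ∈ solvableDom (avOfRecord F N K) (regMSCoPOfRecord F N ν K k s.Ω) (genSet s.Ω k))
    {U : GaugeField (F.P K) 0 (SU N)} (hU : U ∈ regMSCoPOfRecord F N ν K k s.Ω) (hUW : AgreeOn (genSet s.Ω k) (avgFamily (avOfRecord F N K) U) W) :
    wilsonAction4 (UbgMSCoPOfRecord F N ν M g K k s W) ≤ wilsonAction4 U :=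
  (isMinimizer_UbgMSCoPOfRecord ν M g K k s hW).2.2 U hU hUW

/-- Off the solvable set the background on a support is the unit configuration (documented junk default of FILE 1).
[cite: Balaban1988Convergent, (2.12) p.256 (typing convention)] -/
theorem UbgMSCoPOfRecordAt_of_not_mem (ν : Stage7Numerics) (M : ℕ) (g : ℕ → ℝ) (K k : ℕ) (Ω₀ : Set (Site (F.P K) 0)) (s : SeqOfRecord F ν M g K k)
    {W : MSField (F.P K) (SU N)} (hW : W ∉ solvableDom (avOfRecord F N K) (regMSCoPOfRecordAt F N ν K k Ω₀ s.Ω) (genSet s.Ω k)) :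
    UbgMSCoPOfRecordAt F N ν M g K k Ω₀ s W = fun _ => 1 :=
  UminOfRecord_of_not (avOfRecord F N K) (regMSCoPOfRecordAt F N ν K k Ω₀ s.Ω) (by rwa [mem_solvableDom_iff] at hW)

/-- Off the solvable set `U_k(s)(𝐖)` is the unit configuration (documented junk default of FILE 1).
[cite: Balaban1988Convergent, (2.12) p.256 (typing convention)] -/
theorem UbgMSCoPOfRecord_of_not_mem (ν : Stage7Numerics) (M : ℕ) (g : ℕ → ℝ) (K k : ℕ) (s : SeqOfRecord F ν M g K k)
    {W : MSField (F.P K) (SU N)} (hW : W ∉ solvableDom (avOfRecord F N K) (regMSCoPOfRecord F N ν K k s.Ω) (genSet s.Ω k)) :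
    UbgMSCoPOfRecord F N ν M g K k s W = fun _ => 1 :=
  UminOfRecord_of_not (avOfRecord F N K) (regMSCoPOfRecord F N ν K k s.Ω) (by rwa [mem_solvableDom_iff] at hW)

/-- The same junk face with the unit written as `1`. [cite: Balaban1988Convergent, (2.12) p.256 (typing convention)] -/
theorem UbgMSCoPOfRecordAt_eq_one_of_not_mem (ν : Stage7Numerics) (M : ℕ) (g : ℕ → ℝ) (K k : ℕ) (Ω₀ : Set (Site (F.P K) 0))
    (s : SeqOfRecord F ν M g K k) {W : MSField (F.P K) (SU N)}
    (hW : W ∉ solvableDom (avOfRecord F N K) (regMSCoPOfRecordAt F N ν K k Ω₀ s.Ω) (genSet s.Ω k)) :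
    UbgMSCoPOfRecordAt F N ν M g K k Ω₀ s W = 1 :=
  UbgMSCoPOfRecordAt_of_not_mem ν M g K k Ω₀ s hW

/-- The same junk face with the unit written as `1`. [cite: Balaban1988Convergent, (2.12) p.256 (typing convention)] -/
theorem UbgMSCoPOfRecord_eq_one_of_not_mem (ν : Stage7Numerics) (M : ℕ) (g : ℕ → ℝ) (K k : ℕ) (s : SeqOfRecord F ν M g K k)
    {W : MSField (F.P K) (SU N)} (hW : W ∉ solvableDom (avOfRecord F N K) (regMSCoPOfRecord F N ν K k s.Ω) (genSet s.Ω k)) :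
    UbgMSCoPOfRecord F N ν M g K k s W = 1 :=
  UbgMSCoPOfRecord_of_not_mem ν M g K k s hW

/-- **The `Γ₀` clause, SUPPORT READING** (FILE 22 `dist1_W0_lt_of_mem_solvableDom_regMSCo`, re-ranged): solvability at positive length forces on `W₀`
the scale-`0` plaquette bound `εreg·η₀²` at the plaquettes OF THE SUPPORT `Ω₀` with three corners in `Ω₁ᶜ` (there a minimiser EQUALS `W₀`: «U = V₀ on
Ω₁ᶜ», FILE 16 `eq_W0_of_isMinimizer_genSet`) — and, unlike the `Ω₀ = T_η` class, at NO plaquette off the support: the data beyond the support are free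
(print: «the complete model … including all large field regions»). [cite: Balaban1985Variational, (2),(6) p.278; Balaban1988Convergent, p.243, p.255, (1.12) p.248, (2.10)–(2.12) p.256] -/
theorem dist1_W0_lt_of_mem_solvableDom_regMSCoPAt (ν : Stage7Numerics) {K k : ℕ} (hk : 0 < k) (Ω₀ : Set (Site (F.P K) 0))
    (Ω : ℕ → Set (Site (F.P K) 0)) {W : MSField (F.P K) (SU N)}
    (hW : W ∈ solvableDom (avOfRecord F N K) (regMSCoPOfRecordAt F N ν K k Ω₀ Ω) (genSet Ω k))
    (p : Plaq (F.P K) 0) (hp : p ∈ B8Eq17ClassAkV1.plaqsOf Ω₀) (h₁ : p.src ∉ Ω 1) (h₂ : p.src.shift p.μ ∉ Ω 1) (h₃ : p.src.shift p.ν ∉ Ω 1) :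
    dist1 (GaugeField.plaqHol (W 0) p) < ν.εreg * (F.P K).eta 0 ^ 2 := by
  obtain ⟨U₀, hU₀⟩ := hW
  have hb := eq_W0_of_isMinimizer_genSet (avOfRecord F N K) (regMSCoPOfRecordAt F N ν K k Ω₀ Ω) hk Ω hU₀
  have hhol : GaugeField.plaqHol U₀ p = GaugeField.plaqHol (W 0) p :=
    plaqHol_eq_of_bond_eq p (hb _ h₁) (hb _ h₂) (hb _ h₃) (hb _ h₁)
  rw [← hhol]
  exact hU₀.1.1 0 (Nat.zero_le k) p hp

/-- The `Γ₀` clause of the class of record: the `W₀`-plaquette bound on the plaquettes of the SUPPORT OF RECORD with three corners in `Ω₁ᶜ`.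
[cite: Balaban1985Variational, (2),(6) p.278; Balaban1988Convergent, p.255, (1.12) p.248, (2.10)–(2.12) p.256] -/
theorem dist1_W0_lt_of_mem_solvableDom_regMSCoP (ν : Stage7Numerics) {K k : ℕ} (hk : 0 < k) (Ω : ℕ → Set (Site (F.P K) 0))
    {W : MSField (F.P K) (SU N)} (hW : W ∈ solvableDom (avOfRecord F N K) (regMSCoPOfRecord F N ν K k Ω) (genSet Ω k))
    (p : Plaq (F.P K) 0) (hp : p ∈ B8Eq17ClassAkV1.plaqsOf (suppDomOfRecord F ν K Ω))
    (h₁ : p.src ∉ Ω 1) (h₂ : p.src.shift p.μ ∉ Ω 1) (h₃ : p.src.shift p.ν ∉ Ω 1) :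
    dist1 (GaugeField.plaqHol (W 0) p) < ν.εreg * (F.P K).eta 0 ^ 2 :=
  dist1_W0_lt_of_mem_solvableDom_regMSCoPAt ν hk _ Ω hW p hp h₁ h₂ h₃

/-- Contrapositive bookkeeping: a datum whose `W₀` fails the plaquette test at a support plaquette with three corners in `Ω₁ᶜ` is not solvable in the
class on that support. [cite: Balaban1988Convergent, (2.10)–(2.12) p.256 (bookkeeping)] -/
theorem not_mem_solvableDom_regMSCoPAt_of_le_plaq (ν : Stage7Numerics) {K k : ℕ} (hk : 0 < k) (Ω₀ : Set (Site (F.P K) 0))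
    (Ω : ℕ → Set (Site (F.P K) 0)) (W : MSField (F.P K) (SU N)) (p : Plaq (F.P K) 0) (hp : p ∈ B8Eq17ClassAkV1.plaqsOf Ω₀)
    (h₁ : p.src ∉ Ω 1) (h₂ : p.src.shift p.μ ∉ Ω 1) (h₃ : p.src.shift p.ν ∉ Ω 1)
    (hle : ν.εreg * (F.P K).eta 0 ^ 2 ≤ dist1 (GaugeField.plaqHol (W 0) p)) :
    W ∉ solvableDom (avOfRecord F N K) (regMSCoPOfRecordAt F N ν K k Ω₀ Ω) (genSet Ω k) := fun hW =>
  absurd (dist1_W0_lt_of_mem_solvableDom_regMSCoPAt ν hk Ω₀ Ω hW p hp h₁ h₂ h₃) (not_lt.mpr hle)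

/-- The same for the class of record: a datum whose `W₀` fails the plaquette test at a plaquette of the SUPPORT OF RECORD with three corners in `Ω₁ᶜ`
is not solvable; data beyond the support are unconstrained. [cite: Balaban1988Convergent, (2.10)–(2.12) p.256, p.255 (bookkeeping)] -/
theorem not_mem_solvableDom_regMSCoP_of_le_plaq (ν : Stage7Numerics) {K k : ℕ} (hk : 0 < k) (Ω : ℕ → Set (Site (F.P K) 0))
    (W : MSField (F.P K) (SU N)) (p : Plaq (F.P K) 0) (hp : p ∈ B8Eq17ClassAkV1.plaqsOf (suppDomOfRecord F ν K Ω))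
    (h₁ : p.src ∉ Ω 1) (h₂ : p.src.shift p.μ ∉ Ω 1) (h₃ : p.src.shift p.ν ∉ Ω 1)
    (hle : ν.εreg * (F.P K).eta 0 ^ 2 ≤ dist1 (GaugeField.plaqHol (W 0) p)) :
    W ∉ solvableDom (avOfRecord F N K) (regMSCoPOfRecord F N ν K k Ω) (genSet Ω k) :=
  not_mem_solvableDom_regMSCoPAt_of_le_plaq ν hk _ Ω W p hp h₁ h₂ h₃ hle

variable (F N)

/-! ## §4  The data envelope of the background proviso, support edition: regularity of `𝐖` on the COLLAR at scale `0` -/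

/-- **THE REGULAR RETAINED CONFIGURATIONS ON THE DETERMINING SET, SUPPORT EDITION** — FILE 13's `regSuppOfRecord` (p. 256 «we assume that the field
V_{j−1} is regular on Γ_{j−1}») with the scale-`0` clause re-ranged to the COLLAR `Λ₀ := Ω₀ ∖ Ω₁` of the support of record (r12's `pts 0` is the identity, `pts_zero`) ([15] (3) «Λ_j ⊆
Ω_j ∖ Ω_{j+1}»; [III] (1.10) p. 248: there `V₀` IS regular, by the `2LMR₁` separation of `Ω₁` from the large-field regions), scales `1 ≤ j ≤ k` verbatim
(`|W_j(∂p) − 1| < cR·ε_j` on the plaquettes touching `Γ_j(s)`).  The set on which the background proviso is print-true by [15] Thm 1 — NOT asserted.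
[cite: Balaban1988Convergent, (2.10) p.256, (1.10) p.248, p.255; Balaban1985Variational, (3),(7) p.278] -/
def regSuppPOfRecord (ν : Stage7Numerics) (M : ℕ) (g : ℕ → ℝ) (K k : ℕ) (cR : ℝ) (s : SeqOfRecord F ν M g K k) :
    Set (MSField (F.P K) (SU N)) :=
  {W | PlaqSmallOn (B8Eq17ClassAkV1.plaqsOf (suppDomOfRecord F ν K s.Ω \ s.Ω 1)) (cR * epsOfRecord ν g 0) (W 0) ∧
    ∀ j, 1 ≤ j → j ≤ k → PlaqSmallOn (B8Eq17ClassAkV1.plaqsOf (genSet s.Ω k j)) (cR * epsOfRecord ν g j) (W j)}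

/-- Membership (definitional). [cite: Balaban1988Convergent, (2.10) p.256 (bookkeeping)] -/
theorem mem_regSuppPOfRecord_iff (ν : Stage7Numerics) (M : ℕ) (g : ℕ → ℝ) (K k : ℕ) (cR : ℝ) (s : SeqOfRecord F ν M g K k)
    (W : MSField (F.P K) (SU N)) :
    W ∈ regSuppPOfRecord F N ν M g K k cR s ↔
      PlaqSmallOn (B8Eq17ClassAkV1.plaqsOf (suppDomOfRecord F ν K s.Ω \ s.Ω 1)) (cR * epsOfRecord ν g 0) (W 0) ∧
        ∀ j, 1 ≤ j → j ≤ k → PlaqSmallOn (B8Eq17ClassAkV1.plaqsOf (genSet s.Ω k j)) (cR * epsOfRecord ν g j) (W j) := Iff.rfl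

variable {F N}

/-- The collar clause at scale `0`. [cite: Balaban1988Convergent, (1.10) p.248, (2.10) p.256] -/
theorem plaqSmallOn_collar_of_mem_regSuppPOfRecord {ν : Stage7Numerics} {M : ℕ} {g : ℕ → ℝ} {K k : ℕ} {cR : ℝ} {s : SeqOfRecord F ν M g K k}
    {W : MSField (F.P K) (SU N)} (hW : W ∈ regSuppPOfRecord F N ν M g K k cR s) :
    PlaqSmallOn (B8Eq17ClassAkV1.plaqsOf (suppDomOfRecord F ν K s.Ω \ s.Ω 1)) (cR * epsOfRecord ν g 0) (W 0) :=
  hW.1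

/-- The clauses at scales `1 ≤ j ≤ k` (FILE 13's, verbatim). [cite: Balaban1988Convergent, (2.10) p.256] -/
theorem plaqSmallOn_of_mem_regSuppPOfRecord {ν : Stage7Numerics} {M : ℕ} {g : ℕ → ℝ} {K k : ℕ} {cR : ℝ} {s : SeqOfRecord F ν M g K k}
    {W : MSField (F.P K) (SU N)} (hW : W ∈ regSuppPOfRecord F N ν M g K k cR s) {j : ℕ} (hj : 1 ≤ j) (hjk : j ≤ k) :
    PlaqSmallOn (B8Eq17ClassAkV1.plaqsOf (genSet s.Ω k j)) (cR * epsOfRecord ν g j) (W j) :=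
  hW.2 j hj hjk

/-- **FILE 13's ENVELOPE LIES INSIDE THE SUPPORT EDITION**: regularity on all of `Γ₀ = Ω₁ᶜ` gives it on the collar (`Ω₀ ∖ Ω₁ ⊆ Ω₁ᶜ`); FILE 13's is
the print-STRONGER one. [cite: Balaban1988Convergent, (2.2) p.255, (2.10) p.256] -/
theorem regSuppOfRecord_subset_regSuppPOfRecord (ν : Stage7Numerics) (M : ℕ) (g : ℕ → ℝ) (K : ℕ) {k : ℕ} (hk : 0 < k) (cR : ℝ)
    (s : SeqOfRecord F ν M g K k) :
    regSuppOfRecord F N ν M g K k cR s ⊆ regSuppPOfRecord F N ν M g K k cR s := by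
  intro W hW
  refine ⟨fun p hp => hW 0 (Nat.zero_le k) p (B8Eq17ClassAkV1.plaqsOf_mono ?_ hp), fun j _ hjk => hW j hjk⟩
  intro x hx
  show x ∈ pts 0 (gammaRegion s.Ω k 0)
  rw [gammaRegion_zero s.Ω hk, pts_zero]
  exact hx.2

/-- The support edition grows with the located constant (`0 ≤ ε_j`). [cite: Balaban1988Convergent, (2.10) p.256 (bookkeeping)] -/
theorem regSuppPOfRecord_mono (ν : Stage7Numerics) (M : ℕ) (g : ℕ → ℝ) (K k : ℕ) {cR cR' : ℝ} (h : cR ≤ cR')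
    (hε : ∀ j, j ≤ k → 0 ≤ epsOfRecord ν g j) (s : SeqOfRecord F ν M g K k) :
    regSuppPOfRecord F N ν M g K k cR s ⊆ regSuppPOfRecord F N ν M g K k cR' s := fun _ hW =>
  ⟨fun p hp => lt_of_lt_of_le (hW.1 p hp) (mul_le_mul_of_nonneg_right h (hε 0 (Nat.zero_le k))),
    fun j hj hjk p hp => lt_of_lt_of_le (hW.2 j hj hjk p hp) (mul_le_mul_of_nonneg_right h (hε j hjk))⟩

end Literature.MathematicalPhysics.QuantumFieldTheory.Balaban1983to89.Node00
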